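import Summits.ResolutionOfSingularities.ResolutionOfSingularities.Theorems.PurelyInseparableDim4PointZigzagStep
import HarnessLib

/-!
# Purely inseparable four-folds: the STALK DICTIONARY of a zigzag chart — the local ring at an order-`p` point of the
# walk is the local ring of `𝔸⁵_K` at the origin, with the transformed ideal read as `(z^p + F′)` (brick TY-3k part 7,
# cell `res-dim4-pi`)

[OURS · counted 0] (D-0157 DOOR 2; a by-product of the finite-tree assembly of `PIDim4.TerminationImpliesOrderReduction`
offered to the cell's local-ring («presentation») rows, e.g. the E2 / F4-I(3,3) split's row (M) «MODEL»; host item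
stmt-ResolutionOfSingularities-16155, helper). Resolution of singularities in dimension ≥ 4 / characteristic `p` is NOT
proved here or anywhere in this programme.

A ZIGZAG chart `Z ← Y → T` (open immersions `φ`, `ψ`, a point `y`) with `I.comap φ = J.comap ψ` identifies STALKS:
`𝒪_{Z, φ y} ≅ 𝒪_{Y, y} ≅ 𝒪_{T, ψ y}`, and the identification carries `I_{φ y}` onto `J_{ψ y}` (stalk maps of open
immersions are isomorphisms; tree `stalkIdeal_comap_eq_map`).

* `exists_stalkIso_of_zigzag` — the generic statement;
* `exists_stalkIso_hypSheaf_of_zigzag` — the ZIGZAG INVARIANT at `(Z, M, x₀)` with state `s` gives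
  `𝒪_{Z, x₀} ≅ 𝒪_{𝔸⁵_K, ξ}` carrying `M.ideal_{x₀}` onto `((z^p + s.F)·𝒪)_ξ` — the point is PRESENTED by the model;
* **`stalk_step_package`** — after ANY blowing up of `x₀`, every closed order-`p` point `w` over `x₀` is presented by
  the model of an EDGE successor: `𝒪_{W, w} ≅ 𝒪_{𝔸⁵_K, ξ}` carrying `(M.transform π 𝓘_{x₀}).ideal_w` onto
  `((z^p + (step p univ j b s).F)·𝒪)_ξ` with `Edge p univ s (step p univ j b s)` (`zigzag_step_package` + the above).

AI-produced formalisation, weaker than expert review. bears_on: LADDER-RESOLUTION:D157-DOOR2 (res-dim4-pi · TY-3k).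
-/

set_option linter.dupNamespace false -- D-0017: single-problem summit path `Summit.<S>.<S>.…` by design

noncomputable section

universe u

open MvPolynomial Finset CategoryTheory AlgebraicGeometry Opposite TopologicalSpace

namespace Summit.ResolutionOfSingularities.ResolutionOfSingularities.Theorems.PIDim4

open Literature.AlgebraicGeometry.Resolution
open Literature.AlgebraicGeometry.Resolution.Hauser2010
open Literature.AlgebraicGeometry.Resolution.AffinePointBlowup (P A γ coord Wtop ξ)

namespace Equimultiple

/-! ## 1. Stalks along a zigzag chart -/

section Stalk

variable {Z Y T : Scheme.{u}}

/-- **STALK DICTIONARY OF A ZIGZAG CHART.** For open immersions `φ : Y ⟶ Z`, `ψ : Y ⟶ T`, a point `y` and ideal sheaves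
with `I.comap φ = J.comap ψ`: an isomorphism of local rings `𝒪_{Z, φ y} ≅ 𝒪_{T, ψ y}` carrying the stalk ideal
`I_{φ y}` onto `J_{ψ y}`. [cite: BierstoneGrigorievMilmanWlodarczyk2011, Lemma 8.0.3 (2)] -/
theorem exists_stalkIso_of_zigzag (φ : Y ⟶ Z) [IsOpenImmersion φ] (ψ : Y ⟶ T) [IsOpenImmersion ψ] (y : Y)
    (I : Z.IdealSheafData) (J : T.IdealSheafData) (hI : I.comap φ = J.comap ψ) :
    ∃ e : Z.presheaf.stalk (φ y) ≅ T.presheaf.stalk (ψ y),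
      (stalkIdeal I (φ y)).map e.hom.hom = stalkIdeal J (ψ y) := by
  refine ⟨asIso (φ.stalkMap y) ≪≫ (asIso (ψ.stalkMap y)).symm, ?_⟩
  have h1 : (stalkIdeal I (φ y)).map (φ.stalkMap y).hom = (stalkIdeal J (ψ y)).map (ψ.stalkMap y).hom := by
    rw [← stalkIdeal_comap_eq_map, ← stalkIdeal_comap_eq_map, hI]
  rw [Iso.trans_hom, Iso.symm_hom, asIso_hom, CommRingCat.hom_comp, ← Ideal.map_map, h1, Ideal.map_map,
    ← CommRingCat.hom_comp, asIso_inv, IsIso.hom_inv_id, CommRingCat.hom_id, Ideal.map_id]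

end Stalk

/-! ## 2. The zigzag invariant presents the point by the model -/

section Model

variable {K : Type} [Field K] {p : ℕ} [hp : Fact p.Prime] [CharP K p]
variable {Z W Y : Scheme.{0}} {π : W ⟶ Z} {x₀ : Z}

omit hp [CharP K p] in
/-- **The point of a zigzag chart is presented by the model**: under the ZIGZAG INVARIANT at `(Z, M, x₀)` with state
`s`, `𝒪_{Z, x₀} ≅ 𝒪_{𝔸⁵_K, ξ}` carrying `M.ideal_{x₀}` onto `((z^p + s.F)·𝒪)_ξ`.
[cite: BierstoneGrigorievMilmanWlodarczyk2011, Lemma 8.0.3 (2)] [cite: Hauser2010, §F] -/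
theorem exists_stalkIso_hypSheaf_of_zigzag (φ : Y ⟶ Z) [IsOpenImmersion φ] (ψ : Y ⟶ P 4 K) [IsOpenImmersion ψ]
    (y : Y) (hφ : φ y = x₀) (hψ : ψ y = ξ 4 K) (M : MarkedIdeal Z) (s : State K)
    (hM : M.ideal.comap φ = (hypSheaf p s.F).comap ψ) :
    ∃ e : Z.presheaf.stalk x₀ ≅ (P 4 K).presheaf.stalk (ξ 4 K),
      (stalkIdeal M.ideal x₀).map e.hom.hom = stalkIdeal (hypSheaf p s.F) (ξ 4 K) := by
  subst hφ
  obtain ⟨e, he⟩ := exists_stalkIso_of_zigzag φ ψ y M.ideal (hypSheaf p s.F) hM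
  exact hψ ▸ ⟨e, he⟩

/-- **STALK STEP PACKAGE.** Under the ZIGZAG INVARIANT at `(Z, M, x₀)` (`…PointZigzagStep`) and for ANY blowing up
`π : W → Z` of `x₀`: every CLOSED point `w` over `x₀` of order `≥ p` for `M' = M.transform π 𝓘_{x₀}` is PRESENTED by
the model of an EDGE successor — there are `j`, `b` (`b_j = 0`) with `Edge p univ s (step p univ j b s)` and
`𝒪_{W, w} ≅ 𝒪_{𝔸⁵_K, ξ}` carrying `M'.ideal_w` onto `((z^p + (step p univ j b s).F)·𝒪)_ξ`: «blow up the point, pick a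
closed order-`p` point upstairs: its local ring with the transformed ideal is again the model, at the next state».
[cite: Hauser2010, §F (equiconstant points)] [cite: BierstoneGrigorievMilmanWlodarczyk2011, §3.2 and Lemma 8.0.3 (2)] -/
theorem stalk_step_package [IsLocallyNoetherian Z] [IsAlgClosed K] [DecidableEq K] (φ : Y ⟶ Z)
    [IsOpenImmersion φ] (ψ : Y ⟶ P 4 K) [IsOpenImmersion ψ] (y : Y) (hx₀ : IsClosed ({x₀} : Set Z))
    (hφ : φ y = x₀) (hψ : ψ y = ξ 4 K) (M : MarkedIdeal Z) (hmult : M.mult = p) (s : State K)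
    (hM : M.ideal.comap φ = (hypSheaf p s.F).comap ψ) (hF : s.F ≠ 0)
    (hclean : Literature.Barriers.ResolutionOfSingularities.HauserPerlega.IsClean p s.F)
    (hperm : (p : ℕ∞) ≤ CentreBlowup.ordAlong (Finset.univ : Finset (Fin 4)) s.F)
    (hπ : IsBlowup π (Scheme.IdealSheafData.vanishingIdeal (⟨{x₀}, hx₀⟩ : Closeds Z))) {w : W}
    (hw : IsClosed ({w} : Set W)) (hwx : π w = x₀)
    (hord : (p : ℕ∞) ≤ idealOrder
      (M.transform π (Scheme.IdealSheafData.vanishingIdeal (⟨{x₀}, hx₀⟩ : Closeds Z))).ideal w) :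
    ∃ (j : Fin 4) (b : Fin 4 → K), b j = 0 ∧ Edge p Finset.univ s (CentreBlowup.step p Finset.univ j b s) ∧
      ∃ e : W.presheaf.stalk w ≅ (P 4 K).presheaf.stalk (ξ 4 K),
        (stalkIdeal (M.transform π (Scheme.IdealSheafData.vanishingIdeal (⟨{x₀}, hx₀⟩ : Closeds Z))).ideal w).map
            e.hom.hom =
          stalkIdeal (hypSheaf p (CentreBlowup.step p Finset.univ j b s).F) (ξ 4 K) := by
  obtain ⟨j, b, hbj, hedge, Y', φ', ψ', _, _, y', hφ', hψ', hM'⟩ :=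
    zigzag_step_package φ ψ y hx₀ hφ hψ M hmult s hM hF hclean hperm hπ hw hwx hord
  exact ⟨j, b, hbj, hedge, exists_stalkIso_hypSheaf_of_zigzag φ' ψ' y' hφ' hψ' _
    (CentreBlowup.step p Finset.univ j b s) hM'⟩

/-! ## 3. Quotient form: presentation of the local ring of the hypersurface germ -/

/-- **QUOTIENT FORM of the stalk dictionary**: along a zigzag chart, `𝒪_{Z, φ y} ⧸ I_{φ y} ≃+* 𝒪_{T, ψ y} ⧸ J_{ψ y}`
(appended; `Ideal.quotientEquiv` on `exists_stalkIso_of_zigzag`).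
[cite: BierstoneGrigorievMilmanWlodarczyk2011, Lemma 8.0.3 (2)] -/
theorem nonempty_quotient_ringEquiv_of_zigzag {Z' Y' T : Scheme.{u}} (φ : Y' ⟶ Z') [IsOpenImmersion φ]
    (ψ : Y' ⟶ T) [IsOpenImmersion ψ] (y : Y') (I : Z'.IdealSheafData) (J : T.IdealSheafData)
    (hI : I.comap φ = J.comap ψ) :
    Nonempty ((Z'.presheaf.stalk (φ y) ⧸ stalkIdeal I (φ y)) ≃+* (T.presheaf.stalk (ψ y) ⧸ stalkIdeal J (ψ y))) := by
  obtain ⟨e, he⟩ := exists_stalkIso_of_zigzag φ ψ y I J hI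
  exact ⟨Ideal.quotientEquiv _ _ e.commRingCatIsoToRingEquiv he.symm⟩

omit hp [CharP K p] in
/-- **The local ring of the hypersurface germ at the point of a zigzag chart is PRESENTED BY THE MODEL**
(appended): under the ZIGZAG INVARIANT at `(Z, M, x₀)` with state `s`,
`𝒪_{Z, x₀} ⧸ M.ideal_{x₀} ≅ 𝒪_{𝔸⁵_K, ξ} ⧸ ((z^p + s.F)·𝒪)_ξ` in `CommRingCat` — the shape of the cell's «PresentedBy» rows.
[cite: BierstoneGrigorievMilmanWlodarczyk2011, Lemma 8.0.3 (2)] [cite: Hauser2010, §F] -/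
theorem nonempty_quotientIso_hypSheaf_of_zigzag (φ : Y ⟶ Z) [IsOpenImmersion φ] (ψ : Y ⟶ P 4 K)
    [IsOpenImmersion ψ] (y : Y) (hφ : φ y = x₀) (hψ : ψ y = ξ 4 K) (M : MarkedIdeal Z) (s : State K)
    (hM : M.ideal.comap φ = (hypSheaf p s.F).comap ψ) :
    Nonempty (CommRingCat.of (Z.presheaf.stalk x₀ ⧸ stalkIdeal M.ideal x₀) ≅
      CommRingCat.of ((P 4 K).presheaf.stalk (ξ 4 K) ⧸ stalkIdeal (hypSheaf p s.F) (ξ 4 K))) := by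
  obtain ⟨e, he⟩ := exists_stalkIso_hypSheaf_of_zigzag φ ψ y hφ hψ M s hM
  exact ⟨(Ideal.quotientEquiv _ _ e.commRingCatIsoToRingEquiv he.symm).toCommRingCatIso⟩

/-- **STALK STEP PACKAGE, quotient form** (appended): after ANY blowing up of `x₀`, at every closed order-`p` point
`w` over `x₀`, for `M' = M.transform π 𝓘_{x₀}`: `𝒪_{W, w} ⧸ M'.ideal_w ≅ 𝒪_{𝔸⁵_K, ξ} ⧸ ((z^p + (step p univ j b s).F)·𝒪)_ξ`
with `Edge p univ s (step p univ j b s)`. [cite: Hauser2010, §F (equiconstant points)]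
[cite: BierstoneGrigorievMilmanWlodarczyk2011, §3.2 and Lemma 8.0.3 (2)] -/
theorem stalk_step_package_quotient [IsLocallyNoetherian Z] [IsAlgClosed K] [DecidableEq K] (φ : Y ⟶ Z)
    [IsOpenImmersion φ] (ψ : Y ⟶ P 4 K) [IsOpenImmersion ψ] (y : Y) (hx₀ : IsClosed ({x₀} : Set Z))
    (hφ : φ y = x₀) (hψ : ψ y = ξ 4 K) (M : MarkedIdeal Z) (hmult : M.mult = p) (s : State K)
    (hM : M.ideal.comap φ = (hypSheaf p s.F).comap ψ) (hF : s.F ≠ 0)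
    (hclean : Literature.Barriers.ResolutionOfSingularities.HauserPerlega.IsClean p s.F)
    (hperm : (p : ℕ∞) ≤ CentreBlowup.ordAlong (Finset.univ : Finset (Fin 4)) s.F)
    (hπ : IsBlowup π (Scheme.IdealSheafData.vanishingIdeal (⟨{x₀}, hx₀⟩ : Closeds Z))) {w : W}
    (hw : IsClosed ({w} : Set W)) (hwx : π w = x₀)
    (hord : (p : ℕ∞) ≤ idealOrder
      (M.transform π (Scheme.IdealSheafData.vanishingIdeal (⟨{x₀}, hx₀⟩ : Closeds Z))).ideal w) :
    ∃ (j : Fin 4) (b : Fin 4 → K), b j = 0 ∧ Edge p Finset.univ s (CentreBlowup.step p Finset.univ j b s) ∧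
      Nonempty (CommRingCat.of (W.presheaf.stalk w ⧸
          stalkIdeal (M.transform π (Scheme.IdealSheafData.vanishingIdeal (⟨{x₀}, hx₀⟩ : Closeds Z))).ideal w) ≅
        CommRingCat.of ((P 4 K).presheaf.stalk (ξ 4 K) ⧸
          stalkIdeal (hypSheaf p (CentreBlowup.step p Finset.univ j b s).F) (ξ 4 K))) := by
  obtain ⟨j, b, hbj, hedge, Y', φ', ψ', _, _, y', hφ', hψ', hM'⟩ :=
    zigzag_step_package φ ψ y hx₀ hφ hψ M hmult s hM hF hclean hperm hπ hw hwx hord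
  exact ⟨j, b, hbj, hedge, nonempty_quotientIso_hypSheaf_of_zigzag φ' ψ' y' hφ' hψ' _
    (CentreBlowup.step p Finset.univ j b s) hM'⟩

end Model

end Equimultiple

end Summit.ResolutionOfSingularities.ResolutionOfSingularities.Theorems.PIDim4

end
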